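import Summits.MatrixMultiplication.OmegaCensus.Z4Z4DominoSevenTables
import HarnessLib

/-!
# Arithmetic kit for the uniform domino theorem over `A ↠ ℤ₄ × ℤ₄`: the Pell obstruction mod `4`

ω-census `pub-omega`, family (b3), seat pub-omega-group gen 16.  Framing: lottery ticket; floor = certified bounds/negative
ranges.  VALUE: the number-theoretic lemmas behind `no_shifted_form_of_onto_z4z4` (`DominoUniformZ4Z4.lean`); NOT progress on
ω.

For a pulled-back character the shifted domino form gives `a b + u ā b + v a b̄ = r` with `r = −i^l` a unit.  New observation
(from the exact enumerations of gens 14–16, pub-omega-group-g16/code/pell_explore.py): such an identity forces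
* `gcd(Re a, Im a) = 1` (`isCoprime_re_im_of_unit_eq`: a common divisor divides the unit);
* for `(u, v) = (i, ±1)`: the integer `D = x² + 4xy + y²` (`a = x + yi`) divides `x` and `y` (for each of the four units the
  vector `N` with `D b = N` is `±(−y, x+2y)`, `±(x, 2x+y)`, …), hence `D = ±1` (a Pell equation) and — when `x + y` is odd — the
  even one of `x, y` is `≡ 0 (mod 4)` (`kP_mod_four`);
* for `(u, v) = (1, i)`: `D = 3x² − y² = ±1`, so `x ≡ 0 (mod 4)` or `y ≡ 2 (mod 4)` (`kPp_mod_four`); for `(u, v) = (−1, i)`: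
  `D = 3y² − x²`, so `y ≡ 0 (mod 4)` or `x ≡ 2 (mod 4)` (`kPm_mod_four`).
The mod-`8` case analyses are `decide`s over `ZMod 8`.
-/

namespace Summit.MatrixMultiplication.OmegaCensus

open Finset

/-! ## Units, coprimality, transfer mod `8` -/

/-- The four values of `i^l`. [folklore] -/
theorem ipow_cases (l : ZMod 4) : (⟨0, 1⟩ : GaussianInt) ^ l.val = 1 ∨ (⟨0, 1⟩ : GaussianInt) ^ l.val = ⟨0, 1⟩ ∨
    (⟨0, 1⟩ : GaussianInt) ^ l.val = -1 ∨ (⟨0, 1⟩ : GaussianInt) ^ l.val = -⟨0, 1⟩ := by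
  revert l; decide

/-- **Coprimality.**  If `a p + ā q = −i^l` in `ℤ[i]`, then `gcd(Re a, Im a) = 1`: a common divisor `g` of the coordinates
divides `a` and `ā`, hence the unit, so `g² ∣ 1`. [folklore] -/
theorem isCoprime_re_im_of_unit_eq {a p q : GaussianInt} {l : ZMod 4}
    (h : a * p + star a * q = -(⟨0, 1⟩ : GaussianInt) ^ l.val) : IsCoprime a.re a.im := by
  rw [Int.isCoprime_iff_gcd_eq_one]
  obtain ⟨x', hx'⟩ : ((Int.gcd a.re a.im : ℕ) : ℤ) ∣ a.re := Int.gcd_dvd_left ..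
  obtain ⟨y', hy'⟩ : ((Int.gcd a.re a.im : ℕ) : ℤ) ∣ a.im := Int.gcd_dvd_right ..
  set g : ℕ := Int.gcd a.re a.im with hg
  have ha : a = (g : GaussianInt) * ⟨x', y'⟩ := by
    apply Zsqrtd.ext <;> simp [hx', hy']
  have hsa : star a = (g : GaussianInt) * star ⟨x', y'⟩ := by
    rw [ha]; apply Zsqrtd.ext <;> simp
  have hdiv : ((g : ℤ) : GaussianInt) * (⟨x', y'⟩ * p + star ⟨x', y'⟩ * q) = -(⟨0, 1⟩ : GaussianInt) ^ l.val := by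
    rw [← h, hsa, ha]; push_cast; ring
  have hn := congrArg Zsqrtd.norm hdiv
  rw [Zsqrtd.norm_mul, Zsqrtd.norm_neg, norm_ipow, Zsqrtd.norm_intCast] at hn
  have hgg : (g : ℤ) * (g : ℤ) = 1 := Int.eq_one_of_mul_eq_one_right (mul_self_nonneg _) hn
  have hg0 : (0 : ℤ) ≤ g := Int.natCast_nonneg g
  have : (g : ℤ) = 1 := by nlinarith
  exact_mod_cast this

/-- Transfer: `(x : ZMod 8) = c` with `0 ≤ c < 8` gives `x % 8 = c`. [folklore] -/
theorem emod_of_zmod8 {x c : ℤ} (hc : 0 ≤ c) (hc8 : c < 8) (h : (x : ZMod 8) = (c : ZMod 8)) : x % 8 = c := by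
  rw [ZMod.intCast_eq_intCast_iff'] at h
  push_cast at h
  rw [h]; exact Int.emod_eq_of_lt hc hc8

/-- From `D · b = N` componentwise: `D ∣ N.re` and `D ∣ N.im`. [folklore] -/
theorem dvd_re_im_of_key {D : ℤ} {b N : GaussianInt} (key : (⟨D, 0⟩ : GaussianInt) * b = N) : D ∣ N.re ∧ D ∣ N.im := by
  constructor
  · exact ⟨b.re, by rw [← key]; simp⟩
  · exact ⟨b.im, by rw [← key]; simp⟩

/-! ## The mod-`8` Pell analyses (`decide` over `ZMod 8`) -/

/-- `x² + 4xy + y² = ±1`, `x + y` odd (mod `8`): the even one of `x, y` is `≡ 0 (mod 4)`. [folklore] -/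
theorem pellP_mod8 : ∀ x y k : ZMod 8, x + y = 2 * k + 1 →
    (x * x + 4 * x * y + y * y = 1 ∨ x * x + 4 * x * y + y * y = -1) → (x = 0 ∨ x = 4) ∨ (y = 0 ∨ y = 4) := by
  decide

/-- `3x² − y² = ±1`, `x + y` odd (mod `8`): `x ≡ 0 (mod 4)` or `y ≡ 2 (mod 4)`. [folklore] -/
theorem pellPp_mod8 : ∀ x y k : ZMod 8, x + y = 2 * k + 1 →
    (3 * x * x - y * y = 1 ∨ 3 * x * x - y * y = -1) → (x = 0 ∨ x = 4) ∨ (y = 2 ∨ y = 6) := by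
  decide

/-- `3y² − x² = ±1`, `x + y` odd (mod `8`): `y ≡ 0 (mod 4)` or `x ≡ 2 (mod 4)`. [folklore] -/
theorem pellPm_mod8 : ∀ x y k : ZMod 8, x + y = 2 * k + 1 →
    (3 * y * y - x * x = 1 ∨ 3 * y * y - x * x = -1) → (y = 0 ∨ y = 4) ∨ (x = 2 ∨ x = 6) := by
  decide

/-! ## The three divisibility-to-congruence lemmas -/

/-- **`(u, v) = (i, ±1)`**: from `a b + i ā b + v a b̄ = −i^l` with `Re a + Im a` odd, the even coordinate of `a` is
`≡ 0 (mod 4)`. [folklore] -/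
theorem kP_mod_four {a v b : GaussianInt} {l : ZMod 4} (hv : v = 1 ∨ v = -1) (hodd : Odd (a.re + a.im))
    (h : a * b + (⟨0, 1⟩ : GaussianInt) * star a * b + v * a * star b = -(⟨0, 1⟩ : GaussianInt) ^ l.val) :
    a.re % 4 = 0 ∨ a.im % 4 = 0 := by
  have hcop : IsCoprime a.re a.im :=
    isCoprime_re_im_of_unit_eq (p := b + v * star b) (q := (⟨0, 1⟩ : GaussianInt) * b) (l := l) (by rw [← h]; ring)
  have key := det_mul_eq (a + (⟨0, 1⟩ : GaussianInt) * star a) (v * a) (-(⟨0, 1⟩ : GaussianInt) ^ l.val) b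
    (by linear_combination h)
  have hvv : v * star v = 1 := by rcases hv with rfl | rfl <;> simp
  obtain ⟨D, hD⟩ : ∃ D : ℤ, D = a.re * a.re + 4 * a.re * a.im + a.im * a.im := ⟨_, rfl⟩
  have hDe : star (a + (⟨0, 1⟩ : GaussianInt) * star a) * (a + (⟨0, 1⟩ : GaussianInt) * star a) - v * a * star (v * a) =
      ⟨D, 0⟩ := by
    have e1 : star (a + (⟨0, 1⟩ : GaussianInt) * star a) * (a + (⟨0, 1⟩ : GaussianInt) * star a) - v * a * star (v * a) =
        star a * a + star a * (⟨0, 1⟩ : GaussianInt) * star a + star (⟨0, 1⟩ : GaussianInt) * a * a +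
          star (⟨0, 1⟩ : GaussianInt) * (⟨0, 1⟩ : GaussianInt) * (a * star a) - (v * star v) * (a * star a) := by
      simp only [star_add, star_mul, star_star]; ring
    rw [e1, hvv, hD]
    apply Zsqrtd.ext <;> simp <;> ring
  rw [hDe] at key
  -- `D ∣ Re a` and `D ∣ Im a`
  have hxy : D ∣ a.re ∧ D ∣ a.im := by
    obtain ⟨hre, him⟩ := dvd_re_im_of_key key
    rcases hv with rfl | rfl <;> rcases ipow_cases l with hl | hl | hl | hl <;> rw [hl] at hre him <;>
      simp at hre him <;>
      · have c1 := hre.linear_comb him 2 1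
        have c2 := hre.linear_comb him 1 2
        have c3 := hre.linear_comb him 2 (-1)
        have c4 := hre.linear_comb him (-1) 2
        have c5 := hre.linear_comb him 1 (-2)
        have c6 := hre.linear_comb him (-2) 1
        ring_nf (config := { ifUnchanged := .silent }) at hre him c1 c2 c3 c4 c5 c6 ⊢
        constructor <;>
          first
          | exact hre | exact him | exact c1 | exact c2 | exact c3 | exact c4 | exact c5 | exact c6
          | exact dvd_neg.1 hre | exact dvd_neg.1 him | exact dvd_neg.1 c1 | exact dvd_neg.1 c2
  -- `D = ±1`
  have hD1 : D = 1 ∨ D = -1 := Int.isUnit_iff.1 (hcop.isUnit_of_dvd' hxy.1 hxy.2)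
  -- mod `8`
  obtain ⟨k, hk⟩ := hodd
  have hsum : ((a.re : ZMod 8)) + (a.im : ZMod 8) = 2 * (k : ZMod 8) + 1 := by exact_mod_cast congrArg (Int.cast : ℤ → ZMod 8) hk
  have hPell : (a.re : ZMod 8) * (a.re : ZMod 8) + 4 * (a.re : ZMod 8) * (a.im : ZMod 8) + (a.im : ZMod 8) * (a.im : ZMod 8) = 1 ∨
      (a.re : ZMod 8) * (a.re : ZMod 8) + 4 * (a.re : ZMod 8) * (a.im : ZMod 8) + (a.im : ZMod 8) * (a.im : ZMod 8) = -1 := by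
    rcases hD1 with h1 | h1 <;> [left; right] <;>
      · have := congrArg (Int.cast : ℤ → ZMod 8) (hD.symm.trans h1); push_cast at this; exact this
  rcases pellP_mod8 _ _ _ hsum hPell with (h0 | h4) | (h0 | h4)
  · left; have := emod_of_zmod8 (c := 0) (by norm_num) (by norm_num) (by exact_mod_cast h0); omega
  · left; have := emod_of_zmod8 (c := 4) (by norm_num) (by norm_num) (by exact_mod_cast h4); omega
  · right; have := emod_of_zmod8 (c := 0) (by norm_num) (by norm_num) (by exact_mod_cast h0); omega
  · right; have := emod_of_zmod8 (c := 4) (by norm_num) (by norm_num) (by exact_mod_cast h4); omega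

/-- **`(u, v) = (1, i)`**: from `a b + ā b + i a b̄ = −i^l` with `Re a + Im a` odd: `Re a ≡ 0 (mod 4)` or
`Im a ≡ 2 (mod 4)` (`D = 3x² − y² = −1`). [folklore] -/
theorem kPp_mod_four {a b : GaussianInt} {l : ZMod 4} (hodd : Odd (a.re + a.im))
    (h : a * b + 1 * star a * b + (⟨0, 1⟩ : GaussianInt) * a * star b = -(⟨0, 1⟩ : GaussianInt) ^ l.val) :
    a.re % 4 = 0 ∨ a.im % 4 = 2 := by
  have hcop : IsCoprime a.re a.im :=
    isCoprime_re_im_of_unit_eq (p := b + (⟨0, 1⟩ : GaussianInt) * star b) (q := b) (l := l) (by rw [← h]; ring)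
  have key := det_mul_eq (a + star a) ((⟨0, 1⟩ : GaussianInt) * a) (-(⟨0, 1⟩ : GaussianInt) ^ l.val) b
    (by linear_combination h)
  obtain ⟨D, hD⟩ : ∃ D : ℤ, D = 3 * a.re * a.re - a.im * a.im := ⟨_, rfl⟩
  have hDe : star (a + star a) * (a + star a) - (⟨0, 1⟩ : GaussianInt) * a * star ((⟨0, 1⟩ : GaussianInt) * a) = ⟨D, 0⟩ := by
    rw [hD]; simp only [star_add, star_mul, star_star]
    apply Zsqrtd.ext <;> simp <;> ring
  rw [hDe] at key
  -- `D ∣ Re a` and `D ∣ Im a`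
  have hxy : D ∣ a.re ∧ D ∣ a.im := by
    obtain ⟨hre, him⟩ := dvd_re_im_of_key key
    rcases ipow_cases l with hl | hl | hl | hl <;> rw [hl] at hre him <;>
      simp at hre him <;>
      · have c1 := hre.linear_comb him 2 1
        have c2 := hre.linear_comb him 1 2
        have c3 := hre.linear_comb him 2 (-1)
        have c4 := hre.linear_comb him (-1) 2
        have c5 := hre.linear_comb him 1 (-2)
        have c6 := hre.linear_comb him (-2) 1
        ring_nf (config := { ifUnchanged := .silent }) at hre him c1 c2 c3 c4 c5 c6 ⊢
        constructor <;>
          first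
          | exact hre | exact him | exact c1 | exact c2 | exact c3 | exact c4 | exact c5 | exact c6
          | exact dvd_neg.1 hre | exact dvd_neg.1 him | exact dvd_neg.1 c1 | exact dvd_neg.1 c2
  -- `D = ±1`
  have hD1 : D = 1 ∨ D = -1 := Int.isUnit_iff.1 (hcop.isUnit_of_dvd' hxy.1 hxy.2)
  -- mod `8`
  obtain ⟨k, hk⟩ := hodd
  have hsum : ((a.re : ZMod 8)) + (a.im : ZMod 8) = 2 * (k : ZMod 8) + 1 := by exact_mod_cast congrArg (Int.cast : ℤ → ZMod 8) hk
  have hPell : 3 * (a.re : ZMod 8) * (a.re : ZMod 8) - (a.im : ZMod 8) * (a.im : ZMod 8) = 1 ∨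
      3 * (a.re : ZMod 8) * (a.re : ZMod 8) - (a.im : ZMod 8) * (a.im : ZMod 8) = -1 := by
    rcases hD1 with h1 | h1 <;> [left; right] <;>
      · have := congrArg (Int.cast : ℤ → ZMod 8) (hD.symm.trans h1); push_cast at this; exact this
  rcases pellPp_mod8 _ _ _ hsum hPell with (h0 | h4) | (h0 | h4)
  · left; have := emod_of_zmod8 (c := 0) (by norm_num) (by norm_num) (by exact_mod_cast h0); omega
  · left; have := emod_of_zmod8 (c := 4) (by norm_num) (by norm_num) (by exact_mod_cast h4); omega
  · right; have := emod_of_zmod8 (c := 2) (by norm_num) (by norm_num) (by exact_mod_cast h0); omega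
  · right; have := emod_of_zmod8 (c := 6) (by norm_num) (by norm_num) (by exact_mod_cast h4); omega

/-- **`(u, v) = (−1, i)`**: from `a b − ā b + i a b̄ = −i^l` with `Re a + Im a` odd: `Im a ≡ 0 (mod 4)` or
`Re a ≡ 2 (mod 4)` (`D = 3y² − x² = −1`). [folklore] -/
theorem kPm_mod_four {a b : GaussianInt} {l : ZMod 4} (hodd : Odd (a.re + a.im))
    (h : a * b + (-1) * star a * b + (⟨0, 1⟩ : GaussianInt) * a * star b = -(⟨0, 1⟩ : GaussianInt) ^ l.val) :
    a.im % 4 = 0 ∨ a.re % 4 = 2 := by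
  have hcop : IsCoprime a.re a.im :=
    isCoprime_re_im_of_unit_eq (p := b + (⟨0, 1⟩ : GaussianInt) * star b) (q := -b) (l := l) (by rw [← h]; ring)
  have key := det_mul_eq (a - star a) ((⟨0, 1⟩ : GaussianInt) * a) (-(⟨0, 1⟩ : GaussianInt) ^ l.val) b
    (by linear_combination h)
  obtain ⟨D, hD⟩ : ∃ D : ℤ, D = 3 * a.im * a.im - a.re * a.re := ⟨_, rfl⟩
  have hDe : star (a - star a) * (a - star a) - (⟨0, 1⟩ : GaussianInt) * a * star ((⟨0, 1⟩ : GaussianInt) * a) = ⟨D, 0⟩ := by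
    rw [hD]; simp only [star_sub, star_mul, star_star]
    apply Zsqrtd.ext <;> simp <;> ring
  rw [hDe] at key
  -- `D ∣ Re a` and `D ∣ Im a`
  have hxy : D ∣ a.re ∧ D ∣ a.im := by
    obtain ⟨hre, him⟩ := dvd_re_im_of_key key
    rcases ipow_cases l with hl | hl | hl | hl <;> rw [hl] at hre him <;>
      simp at hre him <;>
      · have c1 := hre.linear_comb him 2 1
        have c2 := hre.linear_comb him 1 2
        have c3 := hre.linear_comb him 2 (-1)
        have c4 := hre.linear_comb him (-1) 2
        have c5 := hre.linear_comb him 1 (-2)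
        have c6 := hre.linear_comb him (-2) 1
        ring_nf (config := { ifUnchanged := .silent }) at hre him c1 c2 c3 c4 c5 c6 ⊢
        constructor <;>
          first
          | exact hre | exact him | exact c1 | exact c2 | exact c3 | exact c4 | exact c5 | exact c6
          | exact dvd_neg.1 hre | exact dvd_neg.1 him | exact dvd_neg.1 c1
  -- `D = ±1`
  have hD1 : D = 1 ∨ D = -1 := Int.isUnit_iff.1 (hcop.isUnit_of_dvd' hxy.1 hxy.2)
  -- mod `8`
  obtain ⟨k, hk⟩ := hodd
  have hsum : ((a.re : ZMod 8)) + (a.im : ZMod 8) = 2 * (k : ZMod 8) + 1 := by exact_mod_cast congrArg (Int.cast : ℤ → ZMod 8) hk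
  have hPell : 3 * (a.im : ZMod 8) * (a.im : ZMod 8) - (a.re : ZMod 8) * (a.re : ZMod 8) = 1 ∨
      3 * (a.im : ZMod 8) * (a.im : ZMod 8) - (a.re : ZMod 8) * (a.re : ZMod 8) = -1 := by
    rcases hD1 with h1 | h1 <;> [left; right] <;>
      · have := congrArg (Int.cast : ℤ → ZMod 8) (hD.symm.trans h1); push_cast at this; exact this
  rcases pellPm_mod8 _ _ _ hsum hPell with (h0 | h4) | (h0 | h4)
  · left; have := emod_of_zmod8 (c := 0) (by norm_num) (by norm_num) (by exact_mod_cast h0); omega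
  · left; have := emod_of_zmod8 (c := 4) (by norm_num) (by norm_num) (by exact_mod_cast h4); omega
  · right; have := emod_of_zmod8 (c := 2) (by norm_num) (by norm_num) (by exact_mod_cast h0); omega
  · right; have := emod_of_zmod8 (c := 6) (by norm_num) (by norm_num) (by exact_mod_cast h4); omega

end Summit.MatrixMultiplication.OmegaCensus
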